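import Mathlib
import Summits.Ventures.DiscreteObjects.Mahler.SubLehmerKernelConstraints
import Summits.Ventures.DiscreteObjects.Mahler.SubLehmerPentanomialFourteen
import Summits.Ventures.DiscreteObjects.Mahler.SparseSubLehmer
import Summits.Ventures.DiscreteObjects.Mahler.SubLehmerNoCyclotomicRoot
import Summits.Ventures.DiscreteObjects.Mahler.DobrowolskiWeak

/-!
# Unconditional kernel constraints on an irreducible sub-Lehmer polynomial, II (venture `DiscreteObjects`, target L)

Cell `pub-namedobj`, seat `pub-namedobj-mahler-g28`. Framing: lottery ticket; floor = certified bounds/negative ranges.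

Continuation of `SubLehmerKernelConstraints` (gen 8: reciprocal, even degree, an even coefficient, coefficients not all
`≡ 1 (mod m)`, `M^{4L} > 2`, a non-real root): what the tree proves today, WITHOUT any named fact, about a hypothetical
irreducible `P ∈ ℤ[X]` with `1 < M(P) < M(ℓ) = 1.17628…` — the object target L looks for (`subLehmer_irreducible_constraints_II`):

7. `deg P ≥ 28` — the kernel census at the Lehmer bound for every degree `≤ 27` ('Lehmer ≤ 27', `SubLehmerDegreeTwentyEight`,
   CONTROL/replication of [MRW08], whose printed range is much larger);
8. `P` has at least five monomials ([cite: Dobrowolski2006] line, `SparseSubLehmer`), and if exactly five then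
   `P = ±(x^{2m} + a x^{m+i} + c x^m + a x^{m-i} + 1)`-shaped (up to `x^j`) with `1 ≤ |a| ≤ 4`, `1 ≤ |c| ≤ 7`, `m ≥ 14`
   (`SubLehmerPentanomialFourteen`);
9. no complex root of `P` lies in any cyclotomic field `ℚ(ζ_m)` ([cite: BombieriGubler2001, Theorem 4.4.9] / Schinzel 1973
   for cyclotomic integers, `SubLehmerNoCyclotomicRoot`);
10. the Dobrowolski-type gap `M(P) > 1 + 1/(22 deg P)` ([McKee–Smyth Thm 3.11], `DobrowolskiWeak`).

Items 1–6 are re-exported from `subLehmer_irreducible_constraints`.  Bookkeeping; no new mathematics.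
-/

namespace Summit.Ventures.DiscreteObjects.Mahler

open Polynomial

/-- **Kernel constraints on an irreducible sub-Lehmer polynomial, as of 2026-08-26** (all unconditional; items 7–10 of
the module docstring followed by items 1–6 of `SubLehmerKernelConstraints`). -/
theorem subLehmer_irreducible_constraints_II {P : ℤ[X]} (hirr : Irreducible P) (hP : SubLehmer P) :
    28 ≤ P.natDegree ∧
    5 ≤ P.support.card ∧
    (P.support.card = 5 → ∃ (s : ℤ) (j m i : ℕ) (a c : ℤ), (s = 1 ∨ s = -1) ∧ 0 < i ∧ i < m ∧ 14 ≤ m ∧ a ≠ 0 ∧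
      c ≠ 0 ∧ |a| ≤ 4 ∧ |c| ≤ 7 ∧
      P = C s * X ^ j * (X ^ (2 * m) + C a * X ^ (m + i) + C c * X ^ m + C a * X ^ (m - i) + 1)) ∧
    (∀ m : ℕ, 0 < m → ∀ ζ : ℂ, IsPrimitiveRoot ζ m → ∀ α : ℂ, aeval α P = 0 →
      α ∉ IntermediateField.adjoin ℚ {ζ}) ∧
    1 + 1 / (22 * (P.natDegree : ℝ)) < intMahlerMeasure P ∧
    (P.reverse = P ∧
    (Even P.natDegree ∧ 2 ≤ P.natDegree) ∧
    (∃ i ≤ P.natDegree, ¬ Odd (P.coeff i)) ∧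
    (∀ m : ℤ, 3 ≤ |m| → ∃ i ≤ P.natDegree, ¬ (m ∣ P.coeff i - 1)) ∧
    (2 : ℝ) < intMahlerMeasure P ^ (4 * ∑ i ∈ Finset.range (P.natDegree + 1), (P.coeff i).natAbs) ∧
    (∃ α ∈ (P.map (Int.castRingHom ℂ)).roots, α.im ≠ 0)) := by
  refine ⟨twentyeight_le_natDegree_of_subLehmer hP, five_le_card_support_of_subLehmer' hP, ?_, ?_, ?_,
    subLehmer_irreducible_constraints hirr hP⟩
  · intro h5
    obtain ⟨s, j, m, i, a, c, hs, hi, him, h14, ha, hc, ha4, hc7, -, hPQ⟩ := subLehmer_pentanomial_shape_fourteen hP h5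
    exact ⟨s, j, m, i, a, c, hs, hi, him, h14, ha, hc, ha4, hc7, hPQ⟩
  · intro m hm ζ hζ α hroot
    exact subLehmer_irreducible_root_not_mem_cyclotomicField hirr hP hm hζ hroot
  · exact weakDobrowolski_of_irreducible hirr hP.1

end Summit.Ventures.DiscreteObjects.Mahler
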